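import Literature.Algebra.Semigroups.FullTransformationIdempotents

/-!
# Automorphisms of the full transformation semigroup: `Aut(𝒯ₙ) = Inn(𝒯ₙ) ≅ 𝒮ₙ`

Source: O. Ganyushkin, V. Mazorchuk, *Classical Finite Transformation Semigroups*, Algebra and
Applications 9, Springer (2009) [GanyushkinMazorchuk2009], §7.1 "Automorphisms of `𝒯ₙ`,
`𝒫𝒯ₙ`, and `ℐ𝒮ₙ`": Proposition 7.1.1, Proposition 7.1.2 (i), Theorem 7.1.3 with Lemma 7.1.4
and Case 1 (`S = 𝒯ₙ`) of its proof.

`𝒯(X)` is Mathlib's monoid `Function.End X` (`f * g = f ∘ g`); an automorphism is a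
`MulEquiv`, `Aut(𝒯(X))` is `MulAut (Function.End X)`, and the inner automorphism attached to a
permutation `σ ∈ 𝒮(X) = 𝒯(X)*` is `α ↦ σασ⁻¹` (the book's `Λ_{σ⁻¹}`, cf. Proposition 7.1.2 (i)).

* Proposition 7.1.1: conjugation by a unit is an automorphism of any monoid (`conj_map_mul`,
  `conj_bijective`);
* Lemma 7.1.4: different permutations give different inner automorphisms of `𝒯(X)`
  (`innerAut_injective`);
* Theorem 7.1.3, Case 1: every automorphism `ψ` of `𝒯(X)` is inner — `ψ` permutes the left
  zeros `0_a` (Proposition 2.3.3), `ψ(0_a) = 0_{σ(a)}` defines `σ ∈ 𝒮(X)`, and applying `ψ` to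
  `α 0_b = 0_{α(b)}` gives `ψ(α) = σασ⁻¹` (`exists_perm_eq_conj_of_mulEquiv`); here we conclude
  directly from `M(α) = M(ψ(α))` instead of the book's count `|Aut| ≤ n!`, and no finiteness
  of `X` is needed;
* Theorem 7.1.3: `Aut(𝒯(X)) = Inn(𝒯(X)) ≅ 𝒮(X)`, as a group isomorphism
  `𝒮(X) ≃* MulAut (𝒯(X))` sending `σ` to `α ↦ σασ⁻¹` (`exists_mulEquiv_perm_mulAut`).
-/

namespace Literature.Algebra.Semigroups.FullTransformation

open Function Set

variable {X : Type*}

/-! ### Proposition 7.1.1: inner automorphisms of a monoid -/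

/-- **Proposition 7.1.1**: for a unit `a` of a monoid `S`, `Λ_a : x ↦ a⁻¹xa` is multiplicative.
[cite: GanyushkinMazorchuk2009, Proposition 7.1.1] -/
theorem conj_map_mul {S : Type*} [Monoid S] (a : Sˣ) (x y : S) :
    (↑a⁻¹ * (x * y) * ↑a : S) = (↑a⁻¹ * x * ↑a) * (↑a⁻¹ * y * ↑a) := by
  simp only [mul_assoc, Units.mul_inv_cancel_left]

/-- **Proposition 7.1.1**: for a unit `a` of a monoid `S`, `Λ_a : x ↦ a⁻¹xa` is a bijection
with inverse `Λ_{a⁻¹}`; together with `conj_map_mul`, `Λ_a` is an automorphism of `S`.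
[cite: GanyushkinMazorchuk2009, Proposition 7.1.1] -/
theorem conj_bijective {S : Type*} [Monoid S] (a : Sˣ) :
    Bijective fun x : S => (↑a⁻¹ * x * ↑a : S) := by
  refine bijective_iff_has_inverse.2 ⟨fun x => (↑a * x * ↑a⁻¹ : S), fun x => ?_, fun x => ?_⟩
  · simp only [mul_assoc, Units.mul_inv_cancel_left, Units.mul_inv, mul_one]
  · simp only [mul_assoc, Units.inv_mul_cancel_left, Units.inv_mul, mul_one]

/-! ### Theorem 7.1.3 for `𝒯(X)` -/

/-- **Lemma 7.1.4** (case `𝒯ₙ`): different permutations `σ ≠ τ` induce different inner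
automorphisms `α ↦ σασ⁻¹` of `𝒯(X)` (they differ on a constant map `0_x`).
[cite: GanyushkinMazorchuk2009, Lemma 7.1.4] -/
theorem innerAut_injective :
    Injective fun (σ : Equiv.Perm X) (α : Function.End X) =>
      ((⇑σ : X → X) ∘ α ∘ (⇑σ.symm : X → X) : Function.End X) := by
  intro σ τ h
  ext x
  have := congrFun (congrFun h (const X x : Function.End X)) x
  simpa using this

/-- **Theorem 7.1.3**, Case 1 of the proof (`S = 𝒯ₙ`): every automorphism `ψ` of the full
transformation monoid `𝒯(X)` is inner: there is a permutation `σ` with `ψ(α) = σασ⁻¹` for all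
`α`.  (`σ` is read off from the left zeros: `ψ(0_a) = 0_{σ(a)}`; then `ψ` applied to
`α0_b = 0_{α(b)}` gives `ψ(α)(σ b) = σ(α b)`.)  No finiteness assumption is needed.
[cite: GanyushkinMazorchuk2009, Theorem 7.1.3] -/
theorem exists_perm_eq_conj_of_mulEquiv (ψ : Function.End X ≃* Function.End X) :
    ∃ σ : Equiv.Perm X, ∀ α : Function.End X,
      ψ α = ((⇑σ : X → X) ∘ α ∘ (⇑σ.symm : X → X) : Function.End X) := by
  rcases isEmpty_or_nonempty X with hX | hX
  · refine ⟨Equiv.refl X, fun α => funext fun x => isEmptyElim x⟩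
  -- the constant maps `0_a`, as elements of the monoid `𝒯(X)`
  let c : X → Function.End X := fun a => const X a
  -- `α 0_b = 0_{α b}` (the relation `M(α)` of the printed proof)
  have hmul : ∀ (α : Function.End X) (b : X), α * c b = c (α b) := fun α b => rfl
  -- an automorphism maps left zeros (= constant maps, Proposition 2.3.3) to left zeros
  have hzero : ∀ (φ : Function.End X ≃* Function.End X) (a : X), ∃ b : X, φ (c a) = c b := by
    intro φ a
    refine (isLeftZero_iff (X := X) (φ (c a))).1 fun β => ?_
    let β' : Function.End X := β
    show φ (c a) * β' = φ (c a)
    conv_lhs => rw [← φ.apply_symm_apply β', ← map_mul]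
    rfl
  choose s hs using hzero ψ
  choose t ht using hzero ψ.symm
  inhabit X
  have hst : ∀ b, s (t b) = b := by
    intro b
    have h := hs (t b)
    rw [← ht b, MulEquiv.apply_symm_apply] at h
    exact (congrFun h default).symm
  have hts : ∀ a, t (s a) = a := by
    intro a
    have h := ht (s a)
    rw [← hs a, MulEquiv.symm_apply_apply] at h
    exact (congrFun h default).symm
  let σ : Equiv.Perm X := ⟨s, t, hts, hst⟩
  refine ⟨σ, fun α => funext fun y => ?_⟩
  -- apply `ψ` to `α 0_b = 0_{α b}` with `b = σ⁻¹ y`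
  have h := congrArg ψ (hmul α (t y))
  rw [map_mul, hs, hs, hst] at h
  exact congrFun h y

/-- **Theorem 7.1.3** (case `𝒯ₙ`): `Aut(𝒯(X)) = Inn(𝒯(X)) ≅ 𝒮(X)` — there is a group
isomorphism from the symmetric group `𝒮(X)` onto the automorphism group of `𝒯(X)` sending
`σ` to the inner automorphism `α ↦ σασ⁻¹` (injective by Lemma 7.1.4, surjective by Case 1).
[cite: GanyushkinMazorchuk2009, Theorem 7.1.3] -/
theorem exists_mulEquiv_perm_mulAut :
    ∃ e : Equiv.Perm X ≃* MulAut (Function.End X), ∀ (σ : Equiv.Perm X) (α : Function.End X),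
      e σ α = ((⇑σ : X → X) ∘ α ∘ (⇑σ.symm : X → X) : Function.End X) := by
  -- the inner automorphism attached to `σ`
  let inner : Equiv.Perm X → MulAut (Function.End X) := fun σ =>
    { toFun := fun α => ((⇑σ : X → X) ∘ α ∘ (⇑σ.symm : X → X) : Function.End X)
      invFun := fun α => ((⇑σ.symm : X → X) ∘ α ∘ (⇑σ : X → X) : Function.End X)
      left_inv := fun α => funext fun x => by simp
      right_inv := fun α => funext fun x => by simp
      map_mul' := fun α β => funext fun x => by
        show σ ((α ∘ β) (σ.symm x)) = σ (α (σ.symm (σ (β (σ.symm x)))))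
        rw [Equiv.symm_apply_apply]
        rfl }
  have hinner : ∀ σ α, inner σ α = ((⇑σ : X → X) ∘ α ∘ (⇑σ.symm : X → X) : Function.End X) :=
    fun σ α => rfl
  let φ : Equiv.Perm X →* MulAut (Function.End X) :=
    { toFun := inner
      map_one' := MulEquiv.ext fun α => rfl
      map_mul' := fun σ τ => MulEquiv.ext fun α => rfl }
  have hφ : Bijective φ := by
    constructor
    · intro σ τ h
      exact innerAut_injective (funext fun α => MulEquiv.congr_fun h α)
    · intro ψ
      obtain ⟨σ, hσ⟩ := exists_perm_eq_conj_of_mulEquiv ψ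
      exact ⟨σ, MulEquiv.ext fun α => (hσ α).symm⟩
  exact ⟨MulEquiv.ofBijective φ hφ, fun σ α => rfl⟩

end Literature.Algebra.Semigroups.FullTransformation
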